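import Summits.Parity.BatemanHorn.Theorems.SoloInformedQuinticPrimeCount
import Summits.Parity.BatemanHorn.Theorems.SoloInformedPowerValuesAll

/-!
# SoloInformedPrimePowerNegligible — the `π`-level localisation for every Bateman–Horn polynomial

Solo unit `solo-Parity-informed` (ideation tier, informed mode), session 15; `PLAN.md` §23, CLAIMS C67.

THE PROPER-PRIME-POWER HYPOTHESIS IS A THEOREM.  For every `g ∈ ℤ[X]` with `IsBatemanHornSystem ![g]` and
`deg g ≥ 2`, the proper prime powers among the values contribute
`PP_g(x) = ∑_{1 ≤ n ≤ x, |g(n)| not prime} Λ(|g(n)|) = o(x)` (`properPrimePow_sum_isLittleO`).  The last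
missing input — prime `k`-th powers with `3 ≤ k ≤ d/2` are `o(x / log x)` — is supplied for every `k ≥ 2` at
once by the elementary divided-difference count `SoloInformedPowerValuesAll`
(`eventually_card_powValues_mul_log_le_of_irreducible`), which uses only the irreducibility of `g`.

Consequently, unconditionally and from Mathlib-level inputs only, for every Bateman–Horn polynomial `g` of
degree `≥ 2` the conjunct `BatemanHornConjecture` specialised to `g` is equivalent to each of

* `batemanHornAsymptotic_iff_isEquivalent_psi`:  `ψ_g(x) = ∑_{n ≤ x} Λ(|g(n)|) ~ C(g) x`;
* `batemanHornAsymptotic_iff_largeDivisorSum_isLittleO` (every admissible cut `y`) and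
  `batemanHornAsymptotic_iff_largeDivisorSum_isLittleO_rpowCut` (`y = x^{1-ε}`):
    `T_g(x; y) = ∑_{n ≤ x} ∑_{e ∣ |g(n)|, e > y} μ(e) log e = o(x)`,
  i.e. to pure Möbius cancellation over the LARGE divisors of the values.

No bearing on the truth of the conjecture: this localises it, it does not prove it.
-/

namespace Summit.Parity.BatemanHorn.Theorems

open Finset Filter ArithmeticFunction Asymptotics Polynomial
open scoped ArithmeticFunction.Moebius Topology Classical
open Literature.NumberTheory.Sieve (IsBatemanHornSystem batemanHornConst BatemanHornAsymptotic)

/-! ### Prime `k`-th powers among the values, every `k ≥ 2` -/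

/-- **Prime `k`-th power values are `o(x / log x)`** for every `k ≥ 2` and every Bateman–Horn polynomial:
`#{n ≤ x : g(n) = p^k, p prime} · log x ≤ δ x` eventually. -/
theorem eventually_card_primePow_mul_log_le {g : ℤ[X]} (hg : IsBatemanHornSystem ![g])
    (hdeg : 1 ≤ g.natDegree) {k : ℕ} (hk : 2 ≤ k) {δ : ℝ} (hδ : 0 < δ) :
    ∀ᶠ x : ℕ in atTop,
      (#((Icc 1 x).filter fun n : ℕ => ∃ p : ℕ, p.Prime ∧ g.eval (n : ℤ) = (p : ℤ) ^ k) : ℝ)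
        * Real.log x ≤ δ * x := by
  have hirr : Irreducible g := by simpa using hg.irreducible 0
  have hlc : 0 < g.leadingCoeff := by simpa using hg.leadingCoeff_pos 0
  filter_upwards [eventually_card_powValues_mul_log_le_of_irreducible hirr hdeg hlc hk hδ,
    eventually_ge_atTop 1] with x hx hx1
  refine le_trans (mul_le_mul_of_nonneg_right ?_ (Real.log_nonneg (by exact_mod_cast hx1))) hx
  have hsub : ((Icc 1 x).filter fun n : ℕ => ∃ p : ℕ, p.Prime ∧ g.eval (n : ℤ) = (p : ℤ) ^ k)
      ⊆ (Icc 1 x).filter fun n : ℕ => ∃ m : ℕ, (g.eval (n : ℤ)).natAbs = m ^ k := by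
    intro n hn
    obtain ⟨hnI, p, -, hpe⟩ := mem_filter.mp hn
    refine mem_filter.mpr ⟨hnI, p, ?_⟩
    rw [hpe, Int.natAbs_pow, Int.natAbs_natCast]
  exact_mod_cast card_le_card hsub

/-- **Proper prime powers among the values of a Bateman–Horn polynomial are negligible:**
`∑_{1 ≤ n ≤ x, |g(n)| not prime} Λ(|g(n)|) = o(x)` for every `g` with `IsBatemanHornSystem ![g]` of
degree `≥ 2`. -/
theorem properPrimePow_sum_isLittleO {g : ℤ[X]} (hg : IsBatemanHornSystem ![g]) (hdeg : 2 ≤ g.natDegree) :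
    (fun x : ℕ => ∑ n ∈ (Icc 1 x).filter (fun n : ℕ => ¬Nat.Prime (g.eval (n : ℤ)).natAbs),
        Λ (g.eval (n : ℤ)).natAbs) =o[atTop] fun x : ℕ => (x : ℝ) :=
  properPrimePow_sum_isLittleO_of_smallPrimePowers hg hdeg fun _ hk3 _ _ hδ =>
    eventually_card_primePow_mul_log_le hg (by omega) (by omega) hδ

/-! ### The localisation, every degree `≥ 2` -/

/-- **`BatemanHornAsymptotic ![g] ⟺ ∑_{n ≤ x} Λ(|g(n)|) ~ C(g) x`** for every Bateman–Horn polynomial of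
degree `≥ 2`. -/
theorem batemanHornAsymptotic_iff_isEquivalent_psi {g : ℤ[X]} (hg : IsBatemanHornSystem ![g])
    (hdeg : 2 ≤ g.natDegree) :
    BatemanHornAsymptotic ![g] ↔
      ((fun x : ℕ => ∑ n ∈ Icc 1 x, Λ (g.eval (n : ℤ)).natAbs) ~[atTop]
        fun x : ℕ => batemanHornConst ![g] * (x : ℝ)) :=
  batemanHornAsymptotic_iff_isEquivalent_psi_of_properPrimePow hg (properPrimePow_sum_isLittleO hg hdeg)

/-- **`BatemanHornAsymptotic ![g] ⟺ T_g(x; y) = o(x)`** for every Bateman–Horn polynomial of degree `≥ 2` and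
every admissible cut `y → ∞`, `y log y = o(x)`. -/
theorem batemanHornAsymptotic_iff_largeDivisorSum_isLittleO {g : ℤ[X]} (hg : IsBatemanHornSystem ![g])
    (hdeg : 2 ≤ g.natDegree) {y : ℕ → ℕ} (hy : Tendsto y atTop atTop)
    (hy' : (fun x : ℕ => Real.log (y x) * (y x : ℝ)) =o[atTop] fun x : ℕ => (x : ℝ)) :
    BatemanHornAsymptotic ![g] ↔
      (fun x : ℕ => ∑ n ∈ Icc 1 x,
          ∑ e ∈ ((g.eval (n : ℤ)).natAbs).divisors with y x < (g.eval (n : ℤ)).natAbs / e,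
            (μ ((g.eval (n : ℤ)).natAbs / e) : ℝ) * Real.log ((((g.eval (n : ℤ)).natAbs / e : ℕ)) : ℝ))
        =o[atTop] fun x : ℕ => (x : ℝ) :=
  batemanHornAsymptotic_iff_largeDivisorSum_isLittleO_of_properPrimePow hg hdeg
    (properPrimePow_sum_isLittleO hg hdeg) hy hy'

/-- **`BatemanHornAsymptotic ![g] ⟺ T_g(x; x^{1-ε}) = o(x)`** (`0 < ε < 1`) for every Bateman–Horn polynomial
`g` of degree `≥ 2`: the conjunct's instance for `g` is exactly the cancellation of `μ · log` over the
divisors `e > x^{1-ε}` of the values `|g(n)| ≍ x^d`. -/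
theorem batemanHornAsymptotic_iff_largeDivisorSum_isLittleO_rpowCut {g : ℤ[X]}
    (hg : IsBatemanHornSystem ![g]) (hdeg : 2 ≤ g.natDegree) {ε : ℝ} (hε : 0 < ε) (hε1 : ε < 1) :
    BatemanHornAsymptotic ![g] ↔
      (fun x : ℕ => ∑ n ∈ Icc 1 x,
          ∑ e ∈ ((g.eval (n : ℤ)).natAbs).divisors with
              ⌊(x : ℝ) ^ (1 - ε)⌋₊ < (g.eval (n : ℤ)).natAbs / e,
            (μ ((g.eval (n : ℤ)).natAbs / e) : ℝ) * Real.log ((((g.eval (n : ℤ)).natAbs / e : ℕ)) : ℝ))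
        =o[atTop] fun x : ℕ => (x : ℝ) :=
  batemanHornAsymptotic_iff_largeDivisorSum_isLittleO_rpowCut_of_properPrimePow hg hdeg
    (properPrimePow_sum_isLittleO hg hdeg) hε hε1

end Summit.Parity.BatemanHorn.Theorems
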